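import Summits.QuantumFields.YangMills.Theorems.BalabanUVNodesN06XdLegAtPinsPhysRU

/-!
# BalabanUVNodes ∕ N06 ([B9], `Dag.B9_main`) — ROWS 20–21's `pYDH` (the Φ^Y probe entry Φ^Y_β∘∇_U∘G₀∘D_U of `Letters313HZ` INTO the graded transported site class `bH13 x U`)
# DERIVED ABOVE A CLOSED THRESHOLD from the displayed Φ^Y-(3.45) members `h45Y`, the plaquette binder `hF` and the member facts
# (dag-n06-l's `pYDH_of_pins` (p661566 (R4)) with `Facts347 ∕ RowSum` discharged at the geometry of record; input of the `hLH3`-split edition)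

Track A of `YM-PLAN.md` (cell `pub-ymgap`, HUMAN RULING D-0062), node **N06** = [Balaban1985BackgroundPropagators] Thms 3.1–3.15; seat `pub-ymgap-dag-n06-d`
(gen 15).  WHY (dag-n06-l `ED47-REPLACEMENT-TABLE.md` row `hLH3` — SPLIT: keep `pXDv`, `pXQs` displayed; DERIVE `pYDH`).  The certificate displays
`hLH3 : … → Letters313HZ (𝔬12 x) (𝔭A x) 1 (H x) hgeo wZ hwZ (bH13 x U) BhD13 Bx13 δ12₃ U` whose field `pYDH β` is the (3.45)-type Hölder probe entry of `∇_UG₀D_U` INTO the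
graded transported site class with a FREE constant function `BhD13`.  dag-n06-l's member-∀ `N06HolderPinsGradedAtRecord.pYDH_of_pins` derives it at the pin (P2) from the
PRINTED Φ^Y-(3.45) members `h45Y β μ` of Theorem 3.3 for `G₀ = G(U)` READ AT THE TRANSPORTED BOND CLASS `bHZKT (taxiB U) (sch β) 1` along the displayed schedule, `hF`,
the pins and `Facts347 ∕ RowSum`.  THIS FILE discharges the member facts and CHOOSES the rates exactly as `N06XdLegAtPinsPhysRU.hXd_of_pins_geo9Y` (`α := 1∕2`,
`δF := δ45 − δ₃`, `σ := 1`, `δJ := δ₃ + 1 + δF∕2`, threshold `max M₀ (max M_g M_L)`), with the CLOSED `BhD β := (d+1)·((1+C_Lip)·(Bi β·L)·(CJG d ℓ (trBasis N) 1 (thetaL d ℓ ϑF)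
(w13 (sch β)) δJ·L)·cσ)`: ★★ `pYDH_of_pins_geo9Y : ∃ MY BhD, (∀ β ∈ [0,1), 0 ≤ BhD β) ∧ ∀ x, MY ≤ M → … → ∀ β, pYDH-shape at BhD β, rate δ₃` for ANY `0 ≤ δ₃ < δ45`.
HONEST FRAMING.  Kernel bookkeeping (∃-packaging of a landed member-∀ theorem with landed member-fact theorems and explicit rate choices); the (3.45) members `h45Y` and the
plaquette binder `hF` are HYPOTHESES; nothing of [B9] asserted; COUNT-NEUTRAL; N06 NOT discharged; K1⁹ NOT closed; one finite 𝕋⁴ programme at fixed `ε` — NOT continuum ∕ OS ∕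
mass gap ∕ Clay.  0 `def`, 0 `sorry`.
-/

noncomputable section

namespace Summit.QuantumFields.YangMills.BalabanUVNodes.N06YdLegAtPinsPhysRU

open Literature.MathematicalPhysics.QuantumFieldTheory.Balaban1983to89
open Literature.MathematicalPhysics.QuantumFieldTheory.Balaban1983to89.Node00 (FBondY IBondY SiteY levY toKT CfgY)
open Literature.MathematicalPhysics.QuantumFieldTheory.Balaban1983to89.B9Thm34Ext (toB6)
open Literature.MathematicalPhysics.QuantumFieldTheory.Balaban1983to89.B11SectG (HasMaj BlockNorm RowSum)
open Literature.MathematicalPhysics.QuantumFieldTheory.Balaban1983to89.B9SectDSup (weightNorm)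
open Literature.MathematicalPhysics.QuantumFieldTheory.Balaban1983to89.B9Thm312Whole (cNorm GeoOK)
open Literature.MathematicalPhysics.QuantumFieldTheory.Balaban1983to89.B9Thm312WholeClasses (cNormR)
open Literature.MathematicalPhysics.QuantumFieldTheory.Balaban1983to89.B9RWSums343Holder (HolderProbes)
open Literature.MathematicalPhysics.QuantumFieldTheory.Balaban1983to89.B9RWSums343to347Whole (Facts347)
open Literature.MathematicalPhysics.QuantumFieldTheory.Balaban1983to89.B9RWSums346SecondDiff (DirOps310)
open Literature.MathematicalPhysics.QuantumFieldTheory.Balaban1983to89.B9Thm310Whole (Ops310)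
open Literature.MathematicalPhysics.QuantumFieldTheory.Balaban1983to89.B9CoReadingCoords (coordOpK XBK blkBK cdBₗ cdsBₗ DcoK)
open Literature.MathematicalPhysics.QuantumFieldTheory.Balaban1983to89.B9CoReadingCoordsS (XSK sIK)
open Literature.MathematicalPhysics.QuantumFieldTheory.Balaban1983to89.B9CoReadingCoordsH (XHK)
open Literature.MathematicalPhysics.QuantumFieldTheory.Balaban1983to89.B9CoReadingCoordsHolder (PK)
open Literature.MathematicalPhysics.QuantumFieldTheory.Balaban1983to89.B9CoReadingCoordsTranspose (TrIdx trBasis)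
open Literature.MathematicalPhysics.QuantumFieldTheory.Balaban1983to89.B9PinMembersKLevelV1 (MemberY geo9Y bg9Y)
open Literature.MathematicalPhysics.QuantumFieldTheory.Balaban1983to89.B9BackgroundsKLevelV1R (RegFamY bg9YR MemOfFam mem_of_reg335R)
open Literature.MathematicalPhysics.QuantumFieldTheory.Balaban1983to89.B9GeoLemma21KLevelV1 (geo9Y_len_pos geo9Y_dist_triangle geo9Y_dist_comm rowSum261_geo9Y)
open Literature.MathematicalPhysics.QuantumFieldTheory.Balaban1983to89.B9GeoNormsKLevelV1 (geo9K geo9K_dist_nonneg)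
open Literature.MathematicalPhysics.QuantumFieldTheory.Balaban1983to89.B7Prop2SpecialUnitary (specialUnitaryUnits)
open Literature.MathematicalPhysics.QuantumFieldTheory.Balaban1983to89.B9RWSums347DefiniteFaces (exp261 facts347_exp261_geo9Y)
open B6GlobalChartV1 (PV blkV1) open B6Ineq2142KLevelV1 (β lvl) open B6Geom246MultiLevelTorus (geomT)
open Node00.OpsYSectDCoords (DvcoKH) open Node00.OpsYNablaBridge (chartY)
open B9MultiscaleSmoothPartitionYLip (CLip) open B9SmoothHolderClassT (bHZT bHZKT)
open B9SmoothHolderClassGraded (bHZG bHZKG) open B9GradViaDivLettersTransported (taxiS taxiB)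
open Literature.MathematicalPhysics.QuantumFieldTheory.Balaban1983to89.B9Thm313WholeDvHolderAtPinsGraded (thetaL CJG thetaL_nonneg CJG_nonneg)
open Literature.MathematicalPhysics.QuantumFieldTheory.Balaban1983to89.B9TaxiTransportLadder (plaqV)
open Summit.QuantumFields.YangMills.BalabanUVNodes.N06HolderPinsGradedAtRecord (pYDH_of_pins)
open Summit.QuantumFields.YangMills.BalabanUVNodes.N06XdLegAtPinsPhysRU (one_le_CLip)
open Literature.MathematicalPhysics.QuantumFieldTheory.Balaban1983to89.B9RWSums347DefiniteFaces (geo9Y_scalars)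
open scoped Matrix.Norms.L2Operator

variable {N : ℕ} {d ℓ : ℕ} {hd : 1 ≤ d + 1} {hL : Odd (ℓ + 1) ∧ 1 < ℓ + 1} {b₀ b₁ : ℝ} {Mstar : ℕ}

/-- ★★ **`pYDH` DERIVED ABOVE A CLOSED THRESHOLD** (module docstring): for any target rate `0 ≤ δ₃ < δ45`, from the displayed Φ^Y-(3.45) members `h45Y` (rate `δ45`, constants
`Bi β`, read at `bHZKT (taxiB U) (sch β) 1`), the plaquette binder `hF` (budget `ϑF ≥ 0`) and the pins, there are a threshold `MY` and a non-negative constant function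
`BhD` with `Letters313HZ.pYDH` INTO `bH13 x U` at rate `δ₃` for every member above `MY` — dag-n06-l's `pYDH_of_pins` with `Facts347` (`α := 1∕2`, `δF := δ45 − δ₃`) and
`RowSum` (`σ := 1`) discharged at the geometry of record. [cite: Balaban1985BackgroundPropagators, Thm 3.3 p.399 + (3.45) p.398 + (3.40) p.397 + (3.35) p.396 + p.398 (remark after (3.47)); Balaban1984PropagatorsII, (2.52)–(2.56) pp.232–233 + Lemma 2.1 (2.59)–(2.61) pp.233–234] -/
theorem pYDH_of_pins_geo9Y [NeZero N] [∀ x : MemberY d ℓ hd hL b₀ b₁ Mstar, Fintype (geo9Y x).Site]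
    {R₁ R₂ : RegFamY d ℓ hd hL b₀ b₁ Mstar (Matrix (Fin N) (Fin N) ℂ)} (H : MemberY d ℓ hd hL b₀ b₁ Mstar → Prop)
    (bI : ∀ x : MemberY d ℓ hd hL b₀ b₁ Mstar, FBondY x.toKIdx → IBondY x.toKIdx)
    (hβ1 : ∀ (x : MemberY d ℓ hd hL b₀ b₁ Mstar) (f : FBondY x.toKIdx), (geomT x.D).dist (β x.hN x.D x.hk (bI x f)) (blkV1 x.hN x.D f) ≤ 1)
    (hbI0 : ∀ (x : MemberY d ℓ hd hL b₀ b₁ Mstar) (f : FBondY x.toKIdx), bI x f = bI x ⟨f.src, 0⟩)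
    (hGR : MemOfFam (specialUnitaryUnits (Fin N)) R₁) (c : ℝ) {M₀ a₀ : ℝ} {ϑF : ℝ} (hϑF : 0 ≤ ϑF)
    (hF : ∀ x : MemberY d ℓ hd hL b₀ b₁ Mstar, letI : Fintype (geo9K x.toKIdx).Site := (inferInstance : Fintype (geo9Y x).Site); M₀ ≤ (geo9Y x).M → ∀ α₀ : ℝ, 0 < α₀ → (geo9Y x).M * α₀ ≤ a₀ → ∀ U : (bg9YR (Matrix (Fin N) (Fin N) ℂ) (specialUnitaryUnits (Fin N)) R₁ R₂ x).Cfg, (bg9YR (Matrix (Fin N) (Fin N) ℂ) (specialUnitaryUnits (Fin N)) R₁ R₂ x).Reg335 c α₀ U →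
      (bg9YR (Matrix (Fin N) (Fin N) ℂ) (specialUnitaryUnits (Fin N)) R₁ R₂ x).Reg336 c α₀ U → ∀ (y : Site (PV d ℓ x.m x.K hd hL) 0) (μ' ν' : Fin (d + 1)),
        ‖(plaqV U y μ' ν' : Matrix (Fin N) (Fin N) ℂ) - 1‖ ≤ ϑF * (((((ℓ + 1 : ℕ) : ℝ)) ^ levY x.toKIdx (chartY x.toKIdx y))⁻¹))
    (w13 : ℝ → ℝ) (hw13₀ : ∀ s, 0 ≤ w13 s) (hw13₁ : ∀ s, w13 s ≤ 1) (sch : ℝ → ℝ) (hsch0 : ∀ β', 0 ≤ β' → β' < 1 → 0 < sch β') (hsch1 : ∀ β', 0 ≤ β' → β' < 1 → sch β' < 1)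
    (hwsch : ∀ β', 0 ≤ β' → β' < 1 → 0 < w13 (sch β'))
    (bH13 : ∀ x : MemberY d ℓ hd hL b₀ b₁ Mstar, (bg9YR (Matrix (Fin N) (Fin N) ℂ) (specialUnitaryUnits (Fin N)) R₁ R₂ x).Cfg → BlockNorm (toB6 (geo9Y x) 1 (H x)) (XSK (TrIdx N) x.toKIdx → ℝ))
    (hbH13 : ∀ (x : MemberY d ℓ hd hL b₀ b₁ Mstar) (U : (bg9YR (Matrix (Fin N) (Fin N) ℂ) (specialUnitaryUnits (Fin N)) R₁ R₂ x).Cfg), bH13 x U =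
      letI : Fintype (geo9K x.toKIdx).Site := (inferInstance : Fintype (geo9Y x).Site);
      weightNorm (bHZG (κ := TrIdx N) x.toKIdx (trBasis N) (taxiS x.toKIdx (bg9YR (Matrix (Fin N) (Fin N) ℂ) (specialUnitaryUnits (Fin N)) R₁ R₂ x) (fun U => U) U) (R := (1 : ℝ)) (H := H x) le_rfl w13 hw13₀ hw13₁)
        (fun y => ((geo9Y x).len y)⁻¹) (fun y => inv_nonneg.2 (geo9Y_len_pos x y).le))
    {ιA AA : MemberY d ℓ hd hL b₀ b₁ Mstar → Type}
    (𝔬A : ∀ x : MemberY d ℓ hd hL b₀ b₁ Mstar, Ops310 (geo9Y x) (bg9YR (Matrix (Fin N) (Fin N) ℂ) (specialUnitaryUnits (Fin N)) R₁ R₂ x) (XBK (TrIdx N) x.toKIdx) (XBK (TrIdx N) x.toKIdx) (ιA x) (AA x))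
    (𝔬12 : ∀ x : MemberY d ℓ hd hL b₀ b₁ Mstar, B9Thm312Whole.Ops (geo9Y x) (bg9YR (Matrix (Fin N) (Fin N) ℂ) (specialUnitaryUnits (Fin N)) R₁ R₂ x) (XBK (TrIdx N) x.toKIdx) (XBK (TrIdx N) x.toKIdx) (XHK (TrIdx N) x.toKIdx) (XSK (TrIdx N) x.toKIdx))
    (hDvco12 : ∀ (x : MemberY d ℓ hd hL b₀ b₁ Mstar) (U : (bg9YR (Matrix (Fin N) (Fin N) ℂ) (specialUnitaryUnits (Fin N)) R₁ R₂ x).Cfg), (𝔬12 x).Dv U = DvcoKH x.toKIdx (trBasis N) (bg9YR (Matrix (Fin N) (Fin N) ℂ) (specialUnitaryUnits (Fin N)) R₁ R₂ x) (fun U => U) U)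
    (𝔡A : ∀ x : MemberY d ℓ hd hL b₀ b₁ Mstar, DirOps310 (𝔬A x) (Fin (d + 1)))
    (h𝔡As : ∀ (x : MemberY d ℓ hd hL b₀ b₁ Mstar) (U : (bg9YR (Matrix (Fin N) (Fin N) ℂ) (specialUnitaryUnits (Fin N)) R₁ R₂ x).Cfg), (𝔡A x).Dsd U = fun μ => coordOpK (trBasis N) (fun _ : Fin (d + 1) => cdsBₗ x.toKIdx U μ))
    (𝔭A : ∀ x : MemberY d ℓ hd hL b₀ b₁ Mstar, HolderProbes (geo9Y x) (bg9YR (Matrix (Fin N) (Fin N) ℂ) (specialUnitaryUnits (Fin N)) R₁ R₂ x) (XBK (TrIdx N) x.toKIdx) (XBK (TrIdx N) x.toKIdx) (PK (FBondY x.toKIdx) (Fin (d + 1)) (TrIdx N)) (PK (FBondY x.toKIdx) (Fin (d + 1)) (TrIdx N)))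
    {δ45 δ₃ : ℝ} (hδ₃ : 0 ≤ δ₃) (hδ : δ₃ < δ45) {Bi : ℝ → ℝ} (hBi : ∀ β', 0 ≤ β' → β' < 1 → 0 ≤ Bi β')
    (h45Y : ∀ x : MemberY d ℓ hd hL b₀ b₁ Mstar, letI : Fintype (geo9K x.toKIdx).Site := (inferInstance : Fintype (geo9Y x).Site); M₀ ≤ (geo9Y x).M → ∀ α₀ : ℝ, 0 < α₀ → (geo9Y x).M * α₀ ≤ a₀ → ∀ U : (bg9YR (Matrix (Fin N) (Fin N) ℂ) (specialUnitaryUnits (Fin N)) R₁ R₂ x).Cfg, (bg9YR (Matrix (Fin N) (Fin N) ℂ) (specialUnitaryUnits (Fin N)) R₁ R₂ x).Reg335 c α₀ U →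
      (bg9YR (Matrix (Fin N) (Fin N) ℂ) (specialUnitaryUnits (Fin N)) R₁ R₂ x).Reg336 c α₀ U → ∀ (β' : ℝ) (h0 : 0 ≤ β') (h1 : β' < 1) (μ : Fin (d + 1)),
        HasMaj (bHZKT (κ := TrIdx N) x.toKIdx (trBasis N) (taxiB x.toKIdx (bg9YR (Matrix (Fin N) (Fin N) ℂ) (specialUnitaryUnits (Fin N)) R₁ R₂ x) (fun U => U) U) (R := (1 : ℝ)) (H := H x) (hsch0 β' h0 h1).le (hsch1 β' h0 h1).le (hsch1 β' h0 h1).le) (BlockNorm.ofBlocks (toB6 (geo9Y x) 1 (H x)) (𝔭A x).blkPY)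
          ((𝔭A x).ΦY U β' ∘ₗ ((𝔬12 x).D U ∘ₗ ((𝔬12 x).G0 U ∘ₗ (𝔡A x).Dsd U μ)))
          (fun a a' => Bi β' * (geo9Y x).len a ^ (-β') * Real.exp (-(δ45 * (geo9Y x).dist a a')))) :
    ∃ (MY : ℝ) (BhD : ℝ → ℝ), (∀ β', 0 ≤ β' → β' < 1 → 0 ≤ BhD β') ∧
      ∀ x : MemberY d ℓ hd hL b₀ b₁ Mstar, MY ≤ (geo9Y x).M → ∀ α₀ : ℝ, 0 < α₀ → (geo9Y x).M * α₀ ≤ a₀ →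
        ∀ U : (bg9YR (Matrix (Fin N) (Fin N) ℂ) (specialUnitaryUnits (Fin N)) R₁ R₂ x).Cfg, (bg9YR (Matrix (Fin N) (Fin N) ℂ) (specialUnitaryUnits (Fin N)) R₁ R₂ x).Reg335 c α₀ U →
          (bg9YR (Matrix (Fin N) (Fin N) ℂ) (specialUnitaryUnits (Fin N)) R₁ R₂ x).Reg336 c α₀ U → ∀ β' : ℝ, 0 ≤ β' → β' < 1 →
            HasMaj (bH13 x U) (cNormR 1 (H x) (𝔭A x).blkPY (fun y => (geo9Y_len_pos x y).le) (β' - 1))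
              (((𝔭A x).ΦY U β' ∘ₗ (𝔬12 x).D U ∘ₗ (𝔬12 x).G0 U) ∘ₗ (𝔬12 x).Dv U)
              (fun a a' => BhD β' * Real.exp (-(δ₃ * (geo9Y x).dist a a'))) := by
  -- the member facts of the (3.47) passage at α := 1∕2, δF := δ45 − δ₃, and [4] (2.61) at rate 1
  have hδF : 0 < δ45 - δ₃ := sub_pos.2 hδ
  obtain ⟨Mg, hFa⟩ := facts347_exp261_geo9Y (d := d) (ℓ := ℓ) (hd := hd) (hL := hL) (b₀ := b₀) (b₁ := b₁) (Mstar := Mstar) H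
    (α := 1 / 2) (by norm_num) (by norm_num) hδF
  obtain ⟨ML, c₁, hrow⟩ := rowSum261_geo9Y (d := d) (ℓ := ℓ) (hd := hd) (hL := hL) (b₀ := b₀) (b₁ := b₁) (Mstar := Mstar) 1 one_pos
  set L₀ : ℝ := ((ℓ + 1 : ℕ) : ℝ) with hL₀
  set δJ : ℝ := δ₃ + 1 + 1 / 2 * (δ45 - δ₃) with hδJ
  have hδJ0 : 0 ≤ δJ := by rw [hδJ]; nlinarith
  have h1C : 0 ≤ 1 + CLip d ℓ := by linarith [one_le_CLip d ℓ]
  have hc0 : (0 : ℝ) ≤ max c₁ 0 := le_max_right _ _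
  refine ⟨max M₀ (max Mg ML),
    fun β' => ((d : ℝ) + 1) * ((1 + CLip d ℓ) * (Bi β' * L₀) * ((CJG d ℓ (trBasis N) 1 (thetaL d ℓ ϑF) (w13 (sch β')) δJ) * L₀) * max c₁ 0), ?_, ?_⟩
  · intro β' h0 h1
    have hJ := CJG_nonneg (d := d) (ℓ := ℓ) (trBasis N) (p := (1 : ℝ)) (thetaL_nonneg d ℓ hϑF) (hwsch β' h0 h1) δJ
    have := hBi β' h0 h1
    positivity
  · intro x hM α₀ hα ha U hU hU' β' h0 h1
    have hrowx : ∀ x : MemberY d ℓ hd hL b₀ b₁ Mstar, max M₀ (max Mg ML) ≤ (geo9Y x).M → RowSum (toB6 (geo9Y x) 1 (H x)) 1 (max c₁ 0) :=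
      fun x hM y => (hrow x (((le_max_right _ _).trans (le_max_right _ _)).trans hM) y).trans (le_max_left _ _)
    have hBhD : ∀ (x : MemberY d ℓ hd hL b₀ b₁ Mstar) (β' : ℝ), 0 ≤ β' → β' < 1 →
        ((d : ℝ) + 1) * ((1 + CLip d ℓ) * (Bi β' * L₀) * (CJG d ℓ (trBasis N) 1 (thetaL d ℓ ϑF) (w13 (sch β')) δJ * (geo9Y x).L) * max c₁ 0) ≤
          ((d : ℝ) + 1) * ((1 + CLip d ℓ) * (Bi β' * L₀) * ((CJG d ℓ (trBasis N) 1 (thetaL d ℓ ϑF) (w13 (sch β')) δJ) * L₀) * max c₁ 0) := by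
      intro x β' h0 h1
      have hJ := CJG_nonneg (d := d) (ℓ := ℓ) (trBasis N) (p := (1 : ℝ)) (thetaL_nonneg d ℓ hϑF) (hwsch β' h0 h1) δJ
      have := hBi β' h0 h1
      have hLx : (geo9Y x).L ≤ L₀ := (geo9Y_scalars x).2.1
      gcongr
    exact pYDH_of_pins H bI hβ1 hbI0 hGR c (M₀ := max M₀ (max Mg ML)) (a₀ := a₀) hϑF
      (fun x hM α₀ hα ha U hU hU' => hF x ((le_max_left _ _).trans hM) α₀ hα ha U hU hU')
      (fun x hM => hFa x (((le_max_left _ _).trans (le_max_right _ _)).trans hM)) hrowx w13 hw13₀ hw13₁ sch hsch0 hsch1 hwsch bH13 hbH13 𝔬A 𝔬12 hDvco12 𝔡A h𝔡As 𝔭A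
      (δ₀ := δ45) (δJ := δJ) (δ₃ := δ₃) hBi (le_max_right _ _) hδJ0 hδ₃ (by rw [hδJ] at *; linarith) (by rw [hδJ]; linarith) hBhD
      (fun x hM α₀ hα ha U hU hU' => h45Y x ((le_max_left _ _).trans hM) α₀ hα ha U hU hU') x hM α₀ hα ha U hU hU' β' h0 h1

end Summit.QuantumFields.YangMills.BalabanUVNodes.N06YdLegAtPinsPhysRU

end
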